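import Literature.NumberTheory.Sieve.DrappeauDispersionS1Phase
import Literature.NumberTheory.Sieve.CircleMethodKernel
import HarnessLib

/-!
# Drappeau 2017, §5.5: the piece `ℛ₁(q₀,n₀)` with its phase made explicit, and the Taylor step

Topic `Literature/NumberTheory/Sieve`, part of the formalisation of §5 of S. Drappeau, Proc. London
Math. Soc. (3) 114 (2017) 684–732 = arXiv:1504.05549 (Theorem 5.1 = the named fact
`Literature.NumberTheory.Sieve.Drappeau2017_theorem51`).  Everything here is PROVED; no definition
and no named fact is introduced.

§5.5 (arXiv p. 20): after renaming `q_j → q₀q_j`, `n_j → n₀n_j`,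
`ℛ₁ = ∑ γ(q₀q₁)γ(q₀q₂) ∑ β_{n₀n₁}\bar β_{n₀n₂} ∑_{0<|h|≤H} (1/W) α̂(h/W) e(hμ/W)` with
`μ ≡ a₁\overline{a₂n₀n_j} (q₀q_j)`, and by (5.22) `e(hμ/W)` is the product of three phases; then
"taking the exponential, we may approximate `e(ha₁/(q₀q₁q₂a₂n₀n₁)) = 1 + O(|ha₁|/(q₀q₁q₂|a₂|n₀n₁))`".
For the tree's re-indexed piece (`Drappeau2017.R1piece_eq_reindex`, `DrappeauDispersionS1Reindex`):

* `Drappeau2017.R1piece_reindexed_eq_phase` — the `b`-sum replaced by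
  `1_{(n₀n_j,q₀q_j)=1, n₁≡n₂ (q₀)} ∑_h 1_{W∤h} ψ̂(Mh/W) · (three phases of (5.22))`
  (`Drappeau2017.bsum_fourierChar_eq`; terms with `β_{n₀n_j} = 0`, in particular non-squarefree
  `n₀n_j`, or `(q₁,q₂) > 1`, or `(n₁,n₂) > 1` are zero on both sides);
* `Drappeau2017.norm_sum_mul_fourierChar_sub_le` — the Taylor step inside an `h`-sum:
  `|∑_h f(h) (e(h(θ₁+θ₂)) − e(hθ₂))| ≤ 2π|θ₁| · sup|f| · ∑_h |h|`
  (`CircleMethodKernel.norm_fourierChar_sub_one_le`).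

## References

* S. Drappeau, Proc. London Math. Soc. (3) 114 (2017) 684–732, arXiv:1504.05549, §5.5,
  (5.22)–(5.23). [cite: Drappeau2017, §5.5]
-/

noncomputable section

open Finset Real Complex
open scoped FourierTransform

namespace Literature.NumberTheory.Sieve

namespace Drappeau2017

/-! ### The Taylor step inside an `h`-sum -/

/-- **The Taylor step of §5.5 inside the `h`-sum**: for `|f(h)| ≤ C`,
`|∑_{h∈S} f(h) (e(h(θ₁+θ₂)) − e(hθ₂))| ≤ C · 2π|θ₁| · ∑_{h∈S} |h|`. [cite: Drappeau2017, §5.5] -/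
theorem norm_sum_mul_fourierChar_sub_le (S : Finset ℤ) {f : ℤ → ℂ} {C : ℝ} (hC : ∀ h ∈ S, ‖f h‖ ≤ C)
    (θ₁ θ₂ : ℝ) :
    ‖∑ h ∈ S, f h * ((𝐞 ((h : ℝ) * (θ₁ + θ₂)) : ℂ) - (𝐞 ((h : ℝ) * θ₂) : ℂ))‖ ≤
      C * (2 * Real.pi * |θ₁|) * ∑ h ∈ S, |(h : ℝ)| := by
  rw [Finset.mul_sum]
  refine (norm_sum_le _ _).trans (Finset.sum_le_sum fun h hh => ?_)
  have hC0 : 0 ≤ C := (norm_nonneg _).trans (hC h hh)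
  have e : (𝐞 ((h : ℝ) * (θ₁ + θ₂)) : ℂ) - (𝐞 ((h : ℝ) * θ₂) : ℂ) =
      (𝐞 ((h : ℝ) * θ₂) : ℂ) * ((𝐞 ((h : ℝ) * θ₁) : ℂ) - 1) := by
    rw [mul_add, add_comm, AddChar.map_add_eq_mul, Circle.coe_mul]; ring
  rw [e, norm_mul, norm_mul, Circle.norm_coe, one_mul]
  calc ‖f h‖ * ‖(𝐞 ((h : ℝ) * θ₁) : ℂ) - 1‖ ≤ C * (2 * Real.pi * |(h : ℝ) * θ₁|) :=
        mul_le_mul (hC h hh) (CircleMethodKernel.norm_fourierChar_sub_one_le _) (norm_nonneg _) hC0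
    _ = C * (2 * Real.pi * |θ₁|) * |(h : ℝ)| := by rw [abs_mul]; ring

/-- `∑_{|h| ≤ H} |h| = H(H+1) ≤ 2H²` (`H ≥ 1`) — crudely `≤ (2H+1)·H`. [folklore] -/
theorem sum_Icc_abs_le (H : ℕ) : ∑ h ∈ Finset.Icc (-(H : ℤ)) H, |(h : ℝ)| ≤ (2 * H + 1) * H := by
  calc ∑ h ∈ Finset.Icc (-(H : ℤ)) H, |(h : ℝ)| ≤ ∑ h ∈ Finset.Icc (-(H : ℤ)) H, (H : ℝ) := by
        refine Finset.sum_le_sum fun h hh => ?_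
        rw [Finset.mem_Icc] at hh
        rw [← Int.cast_abs]
        exact_mod_cast abs_le.2 ⟨hh.1, hh.2⟩
    _ = (2 * H + 1) * H := by
        rw [Finset.sum_const, nsmul_eq_mul, Int.card_Icc]
        have e : ((H : ℤ) + 1 - -(H : ℤ)).toNat = 2 * H + 1 := by omega
        rw [e]; push_cast; ring

/-! ### The piece with its phase made explicit -/

/-- **Drappeau 2017, §5.5: the re-indexed piece `ℛ₁(q₀,n₀)` with the phase of (5.22).**  For
`q₀, n₀ ≥ 1` with `(q₀,n₀) = 1`, ranges `A` (`q ≥ 1`, `(q₀q, a₁a₂) = 1`) and `B` (`n ≥ 1`,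
`(n₀n, a₂) = 1`), and `β` supported on squarefree integers, the `b`-sum of the re-indexed piece
(`R1piece_eq_reindex`) may be replaced by
`1_{(n₀n_j,q₀q_j)=1, n₁≡n₂ (q₀)} ∑_{|h|≤H, W∤h} ψ̂(Mh/W) e(ha₁/(Wa₂n₀n₁)) e(ha₁tu/(n₁q₂)) e(−ha₁v/(a₂n₀))`
(`W = q₀q₁q₂`, `t = (n₁−n₂)/q₀`, `u = \overline{q₁a₂n₀n₂} (n₁q₂)`, `v = \overline{q₀q₁q₂n₁} (|a₂|n₀)`).
[cite: Drappeau2017, §5.5, (5.22)–(5.23)] -/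
theorem R1piece_reindexed_eq_phase {a₁ a₂ : ℤ} (ha₂ : a₂ ≠ 0) {A B : Finset ℕ} {q₀ n₀ : ℕ}
    (hq₀ : 0 < q₀) (hn₀ : 0 < n₀) (hqn : Nat.Coprime q₀ n₀)
    (hA : ∀ q ∈ A, 0 < q ∧ IsCoprime (((q₀ * q : ℕ)) : ℤ) (a₁ * a₂))
    (hB : ∀ n ∈ B, 0 < n ∧ IsCoprime (((n₀ * n : ℕ)) : ℤ) a₂)
    (γ : ℕ → ℝ) {β : ℕ → ℂ} (hβs : ∀ n, ¬Squarefree n → β n = 0) (M : ℝ) (H : ℕ) :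
    ∑ q₁ ∈ A, ∑ q₂ ∈ A, (γ (q₀ * q₁) : ℂ) * (γ (q₀ * q₂) : ℂ) *
        ∑ n₁ ∈ B, ∑ n₂ ∈ B,
          (if (Nat.Coprime q₁ q₂ ∧ Nat.Coprime n₁ n₂) then (1 : ℂ) else 0) *
            (β (n₀ * n₁) * starRingEnd ℂ (β (n₀ * n₂))) *
          ((M : ℂ) / (Nat.lcm (q₀ * q₁) (q₀ * q₂) : ℂ) *
            ∑ b ∈ (Finset.range (Nat.lcm (q₀ * q₁) (q₀ * q₂))).filter (fun b : ℕ =>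
                (b : ZMod (q₀ * q₁)) * ((((n₀ * n₁ : ℕ)) : ZMod (q₀ * q₁)) * (a₂ : ZMod (q₀ * q₁))) =
                  (a₁ : ZMod (q₀ * q₁)) ∧
                (b : ZMod (q₀ * q₂)) * ((((n₀ * n₂ : ℕ)) : ZMod (q₀ * q₂)) * (a₂ : ZMod (q₀ * q₂))) =
                  (a₁ : ZMod (q₀ * q₂))),
              ∑ h ∈ Finset.Icc (-(H : ℤ)) H,
                (if ((Nat.lcm (q₀ * q₁) (q₀ * q₂) : ℕ) : ℤ) ∣ h then 0 else
                  𝓕 (BFI.bumpC 1 (1 / 2)) (M * h / (Nat.lcm (q₀ * q₁) (q₀ * q₂) : ℕ)) *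
                    (𝐞 ((b : ℝ) * h / (Nat.lcm (q₀ * q₁) (q₀ * q₂) : ℕ)) : ℂ))) =
      ∑ q₁ ∈ A, ∑ q₂ ∈ A, (γ (q₀ * q₁) : ℂ) * (γ (q₀ * q₂) : ℂ) *
        ∑ n₁ ∈ B, ∑ n₂ ∈ B,
          (if (Nat.Coprime q₁ q₂ ∧ Nat.Coprime n₁ n₂) then (1 : ℂ) else 0) *
            (β (n₀ * n₁) * starRingEnd ℂ (β (n₀ * n₂))) *
          ((M : ℂ) / (Nat.lcm (q₀ * q₁) (q₀ * q₂) : ℂ) *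
            (if ((n₀ * n₁).Coprime (q₀ * q₁) ∧ (n₀ * n₂).Coprime (q₀ * q₂) ∧ n₁ ≡ n₂ [MOD q₀]) then
              ∑ h ∈ Finset.Icc (-(H : ℤ)) H,
                (if ((Nat.lcm (q₀ * q₁) (q₀ * q₂) : ℕ) : ℤ) ∣ h then 0 else
                  𝓕 (BFI.bumpC 1 (1 / 2)) (M * h / (Nat.lcm (q₀ * q₁) (q₀ * q₂) : ℕ)) *
                    ((𝐞 ((h : ℝ) * a₁ / ((q₀ : ℝ) * q₁ * q₂ * a₂ * n₀ * n₁)) : ℂ) *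
                      (𝐞 ((h : ℝ) * a₁ * ((((n₁ : ℤ) - n₂) / q₀ : ℤ)) *
                        ((((((q₁ : ℤ) * a₂ * n₀ * n₂ : ℤ) : ZMod (n₁ * q₂))⁻¹).val : ℕ) : ℝ) /
                          ((n₁ : ℝ) * q₂)) : ℂ) *
                      (𝐞 (-((h : ℝ) * a₁ *
                        ((((((q₀ : ℤ) * q₁ * q₂ * n₁ : ℤ) : ZMod (a₂.natAbs * n₀))⁻¹).val : ℕ) : ℝ) /
                          ((a₂ : ℝ) * n₀))) : ℂ)))
            else 0)) := by
  refine Finset.sum_congr rfl fun q₁ hq₁ => Finset.sum_congr rfl fun q₂ hq₂ => ?_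
  congr 1
  refine Finset.sum_congr rfl fun n₁ hn₁ => Finset.sum_congr rfl fun n₂ hn₂ => ?_
  obtain ⟨hq₁0, hcq₁⟩ := hA q₁ hq₁
  obtain ⟨hq₂0, hcq₂⟩ := hA q₂ hq₂
  obtain ⟨hn₁0, hcn₁⟩ := hB n₁ hn₁
  obtain ⟨hn₂0, _⟩ := hB n₂ hn₂
  -- trivial cases
  by_cases hcop : (Nat.Coprime q₁ q₂ ∧ Nat.Coprime n₁ n₂)
  swap
  · rw [if_neg hcop]; simp
  rw [if_pos hcop]
  by_cases hβ₁ : β (n₀ * n₁) = 0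
  · rw [hβ₁]; simp
  by_cases hβ₂ : β (n₀ * n₂) = 0
  · rw [hβ₂]; simp
  have hsq₁ : Squarefree (n₀ * n₁) := not_not.1 fun h => hβ₁ (hβs _ h)
  have hn₀₁ : Nat.Coprime n₀ n₁ := (Nat.squarefree_mul_iff.1 hsq₁).1
  congr 2
  -- positivity, units
  have hQ₁ : 0 < q₀ * q₁ := Nat.mul_pos hq₀ hq₁0
  have hQ₂ : 0 < q₀ * q₂ := Nat.mul_pos hq₀ hq₂0
  have hg : Nat.gcd (q₀ * q₁) (q₀ * q₂) = q₀ := by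
    rw [Nat.gcd_mul_left, hcop.1.gcd_eq_one, mul_one]
  obtain ⟨hu₁, hu₂⟩ := isUnit_of_isCoprime_mul hcq₁
  obtain ⟨hu₁', hu₂'⟩ := isUnit_of_isCoprime_mul hcq₂
  -- the conditions, in the two forms
  have hiff : ((n₀ * n₁).Coprime (q₀ * q₁) ∧ (n₀ * n₂).Coprime (q₀ * q₂) ∧
      (((n₀ * n₁ : ℕ)) : ZMod (Nat.gcd (q₀ * q₁) (q₀ * q₂))) =
        (((n₀ * n₂ : ℕ)) : ZMod (Nat.gcd (q₀ * q₁) (q₀ * q₂)))) ↔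
      ((n₀ * n₁).Coprime (q₀ * q₁) ∧ (n₀ * n₂).Coprime (q₀ * q₂) ∧ n₁ ≡ n₂ [MOD q₀]) := by
    rw [ZMod.natCast_eq_natCast_iff, hg]
    refine ⟨fun h => ⟨h.1, h.2.1, ?_⟩, fun h => ⟨h.1, h.2.1, h.2.2.mul_left n₀⟩⟩
    exact Nat.ModEq.cancel_left_of_coprime (c := n₀) hqn h.2.2
  by_cases hc : ((n₀ * n₁).Coprime (q₀ * q₁) ∧ (n₀ * n₂).Coprime (q₀ * q₂) ∧ n₁ ≡ n₂ [MOD q₀])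
  · rw [if_pos hc]
    -- swap `b` and `h`, pull the `h`-only factors out, and use (5.22)
    rw [Finset.sum_comm]
    refine Finset.sum_congr rfl fun h _ => ?_
    by_cases hdvd : ((Nat.lcm (q₀ * q₁) (q₀ * q₂) : ℕ) : ℤ) ∣ h
    · simp only [if_pos hdvd, Finset.sum_const_zero]
    · simp only [if_neg hdvd, ← Finset.mul_sum]
      congr 1
      have hcq : IsCoprime (((q₀ * q₁ * q₂ : ℕ)) : ℤ) (a₁ * a₂) := by
        have h1 : IsCoprime (q₂ : ℤ) (a₁ * a₂) :=
          hcq₂.of_isCoprime_of_dvd_left (by exact_mod_cast dvd_mul_left q₂ q₀)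
        have := IsCoprime.mul_left hcq₁ h1
        push_cast at this ⊢
        exact this
      have hcn₁' : IsCoprime (n₁ : ℤ) a₂ :=
        hcn₁.of_isCoprime_of_dvd_left (by exact_mod_cast dvd_mul_left n₁ n₀)
      exact bsum_fourierChar_eq hq₀ hq₁0 hq₂0 hn₀ hn₁0 ha₂ hcop.1 hcop.2 hn₀₁ hc.1 hc.2.1 hc.2.2
        hcq hcn₁' h
  · rw [if_neg hc]
    obtain ⟨μ, _, _, hsum⟩ := sum_filter_lcm_eq_ite hQ₁ hQ₂ hu₁ hu₁' hu₂ hu₂' (n₀ * n₁) (n₀ * n₂)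
    rw [hsum, if_neg (fun h' => hc (hiff.1 h'))]

end Drappeau2017

end Literature.NumberTheory.Sieve

end
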